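import Summits.SmoothPoincare4.SmoothPoincare4.Theses.EuclideanOrigami

/-!
# Birth skeleton — piece `QuadrupleCancellation` of the crease ladder (crux `CreaseCollapse`,
stmt-SmoothPoincare4-7481, route EuclideanOrigami)

Line `ladder_quad`: PARITY then PAIRS. `stub_quadParity`: a tame crease can be traded (genericity near
the crease, keeping the immersed fake ball) for a tame crease with an EVEN number of quadruple values —
for a self-transverse crease the quadruple points are the quadruple values, and their number is even
because the crease bounds the immersion `F` of the fake ball, i.e. is null-bordant as a codimension-one
immersion, and the number of quadruple points mod 2 is a bordism invariant (Freedman 1978; Eccles 1980,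
1981; Herbert 1981). `stub_quadPairCancel`: an even non-zero number of quadruple values can be lowered
by an even amount keeping tameness (a Whitney-type cancellation of a pair of quadruple points performed
THROUGH immersed fake balls — the crux of the line). The composition `QuadrupleCancellation_of` is a
strong induction on the even count down to a quadruple-free tame crease, which has fewer quadruple
values than the given one.
-/

set_option linter.dupNamespace false

namespace Summit.SmoothPoincare4.SmoothPoincare4.Cruxes.CreaseCollapse.LadderQuad

open scoped Manifold ContDiff Topology
open Set Function

/-- Local copy of the piece (verbatim the route child `QuadrupleCancellation`). -/
def QuadrupleCancellation : Prop :=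
  ∀ (S : Literature.Topology.FourManifolds.HomotopySphere 4) (e : EuclideanSpace ℝ (Fin 4) → S.carrier) (F : S.carrier → EuclideanSpace ℝ (Fin 4)), Manifold.IsSmoothEmbedding (𝓡 4) (𝓡 4) ∞ e → (∀ x, x ∉ e '' Metric.ball (0 : EuclideanSpace ℝ (Fin 4)) 1 → IsLocalDiffeomorphAt (𝓡 4) (𝓡 4) ∞ F x) → {y : EuclideanSpace ℝ (Fin 4) | ∃ a b c d : EuclideanSpace ℝ (Fin 4), ‖a‖ = 1 ∧ ‖b‖ = 1 ∧ ‖c‖ = 1 ∧ ‖d‖ = 1 ∧ a ≠ b ∧ a ≠ c ∧ a ≠ d ∧ b ≠ c ∧ b ≠ d ∧ c ≠ d ∧ F (e a) = y ∧ F (e b) = y ∧ F (e c) = y ∧ F (e d) = y}.Finite → {y : EuclideanSpace ℝ (Fin 4) | ∃ a b c d : EuclideanSpace ℝ (Fin 4), ‖a‖ = 1 ∧ ‖b‖ = 1 ∧ ‖c‖ = 1 ∧ ‖d‖ = 1 ∧ a ≠ b ∧ a ≠ c ∧ a ≠ d ∧ b ≠ c ∧ b ≠ d ∧ c ≠ d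 ∧ F (e a) = y ∧ F (e b) = y ∧ F (e c) = y ∧ F (e d) = y}.Nonempty → ((fun y => connectedComponentIn {y : EuclideanSpace ℝ (Fin 4) | ∃ u v w : EuclideanSpace ℝ (Fin 4), ‖u‖ = 1 ∧ ‖v‖ = 1 ∧ ‖w‖ = 1 ∧ u ≠ v ∧ v ≠ w ∧ u ≠ w ∧ F (e u) = y ∧ F (e v) = y ∧ F (e w) = y} y) '' {y : EuclideanSpace ℝ (Fin 4) | ∃ u v w : EuclideanSpace ℝ (Fin 4), ‖u‖ = 1 ∧ ‖v‖ = 1 ∧ ‖w‖ = 1 ∧ u ≠ v ∧ v ≠ w ∧ u ≠ w ∧ F (e u) = y ∧ F (e v) = y ∧ F (e w) = y}).Finite → ∃ F' : S.carrier → EuclideanSpace ℝ (Fin 4), (∀ x, x ∉ e '' Metric.ball (0 : EuclideanSpace ℝ (Fin 4)) 1 → IsLocalDiffeomorphAt (𝓡 4) (𝓡 4) ∞ F' x) ∧ {y : EuclideanSpace ℝ (Fin 4) | ∃ a b c d : EuclideanSpace ℝ (Fin 4), ‖a‖ = 1 ∧ ‖b‖ = 1 ∧ ‖c‖ = 1 ∧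 ‖d‖ = 1 ∧ a ≠ b ∧ a ≠ c ∧ a ≠ d ∧ b ≠ c ∧ b ≠ d ∧ c ≠ d ∧ F' (e a) = y ∧ F' (e b) = y ∧ F' (e c) = y ∧ F' (e d) = y}.Finite ∧ {y : EuclideanSpace ℝ (Fin 4) | ∃ a b c d : EuclideanSpace ℝ (Fin 4), ‖a‖ = 1 ∧ ‖b‖ = 1 ∧ ‖c‖ = 1 ∧ ‖d‖ = 1 ∧ a ≠ b ∧ a ≠ c ∧ a ≠ d ∧ b ≠ c ∧ b ≠ d ∧ c ≠ d ∧ F' (e a) = y ∧ F' (e b) = y ∧ F' (e c) = y ∧ F' (e d) = y}.ncard < {y : EuclideanSpace ℝ (Fin 4) | ∃ a b c d : EuclideanSpace ℝ (Fin 4), ‖a‖ = 1 ∧ ‖b‖ = 1 ∧ ‖c‖ = 1 ∧ ‖d‖ = 1 ∧ a ≠ b ∧ a ≠ c ∧ a ≠ d ∧ b ≠ c ∧ b ≠ d ∧ c ≠ d ∧ F (e a) = y ∧ F (e b) = y ∧ F (e c) = y ∧ F (e d) = y}.ncard ∧ ((fun y => connectedComponentIn {y : EuclideanSpace ℝ (Fin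 4) | ∃ u v w : EuclideanSpace ℝ (Fin 4), ‖u‖ = 1 ∧ ‖v‖ = 1 ∧ ‖w‖ = 1 ∧ u ≠ v ∧ v ≠ w ∧ u ≠ w ∧ F' (e u) = y ∧ F' (e v) = y ∧ F' (e w) = y} y) '' {y : EuclideanSpace ℝ (Fin 4) | ∃ u v w : EuclideanSpace ℝ (Fin 4), ‖u‖ = 1 ∧ ‖v‖ = 1 ∧ ‖w‖ = 1 ∧ u ≠ v ∧ v ≠ w ∧ u ≠ w ∧ F' (e u) = y ∧ F' (e v) = y ∧ F' (e w) = y}).Finite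

/-- The triple-value set of the crease of `F`. -/
def tripleValues {S : Literature.Topology.FourManifolds.HomotopySphere 4}
    (e : EuclideanSpace ℝ (Fin 4) → S.carrier) (F : S.carrier → EuclideanSpace ℝ (Fin 4)) :
    Set (EuclideanSpace ℝ (Fin 4)) :=
  {y : EuclideanSpace ℝ (Fin 4) | ∃ u v w : EuclideanSpace ℝ (Fin 4), ‖u‖ = 1 ∧ ‖v‖ = 1 ∧ ‖w‖ = 1 ∧
    u ≠ v ∧ v ≠ w ∧ u ≠ w ∧ F (e u) = y ∧ F (e v) = y ∧ F (e w) = y}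

/-- The quadruple-value set of the crease of `F`. -/
def quadValues {S : Literature.Topology.FourManifolds.HomotopySphere 4}
    (e : EuclideanSpace ℝ (Fin 4) → S.carrier) (F : S.carrier → EuclideanSpace ℝ (Fin 4)) :
    Set (EuclideanSpace ℝ (Fin 4)) :=
  {y : EuclideanSpace ℝ (Fin 4) | ∃ a b c d : EuclideanSpace ℝ (Fin 4), ‖a‖ = 1 ∧ ‖b‖ = 1 ∧ ‖c‖ = 1 ∧
    ‖d‖ = 1 ∧ a ≠ b ∧ a ≠ c ∧ a ≠ d ∧ b ≠ c ∧ b ≠ d ∧ c ≠ d ∧ F (e a) = y ∧ F (e b) = y ∧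
    F (e c) = y ∧ F (e d) = y}

/-- The set of connected components of a subset `T ⊆ ℝ⁴`. -/
def components (T : Set (EuclideanSpace ℝ (Fin 4))) : Set (Set (EuclideanSpace ℝ (Fin 4))) :=
  (fun y => connectedComponentIn T y) '' T

/-- The immersion clause of an immersed fake ball (local diffeomorphism off `e(B̊⁴)`). -/
def IsImmersedFakeBall {S : Literature.Topology.FourManifolds.HomotopySphere 4}
    (e : EuclideanSpace ℝ (Fin 4) → S.carrier) (F : S.carrier → EuclideanSpace ℝ (Fin 4)) : Prop :=
  ∀ x, x ∉ e '' Metric.ball (0 : EuclideanSpace ℝ (Fin 4)) 1 → IsLocalDiffeomorphAt (𝓡 4) (𝓡 4) ∞ F x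

/-- Tameness of a crease: finitely many quadruple values, finitely many triple-value components. -/
def IsTame {S : Literature.Topology.FourManifolds.HomotopySphere 4}
    (e : EuclideanSpace ℝ (Fin 4) → S.carrier) (F : S.carrier → EuclideanSpace ℝ (Fin 4)) : Prop :=
  (quadValues e F).Finite ∧ (components (tripleValues e F)).Finite

/-- **stub_quadParity** (genericity + Freedman–Eccles parity): a tame crease of an immersed fake ball
can be traded for a tame crease with an EVEN number of quadruple values (perturb `F` near `e(S³)` to a
self-transverse crease — its quadruple values are then its quadruple points, finite in number, and that
number is even because the crease is null-bordant as a codimension-one immersion: it bounds the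
immersion `(F, ρ) : Δ_e ↬ ℝ⁴ × ℝ₊`; Freedman 1978, Eccles 1980 §1). Size L. -/
theorem stub_quadParity :
    ∀ (S : Literature.Topology.FourManifolds.HomotopySphere 4) (e : EuclideanSpace ℝ (Fin 4) → S.carrier)
      (F : S.carrier → EuclideanSpace ℝ (Fin 4)), Manifold.IsSmoothEmbedding (𝓡 4) (𝓡 4) ∞ e →
      IsImmersedFakeBall e F → IsTame e F →
      ∃ F₁ : S.carrier → EuclideanSpace ℝ (Fin 4), IsImmersedFakeBall e F₁ ∧ IsTame e F₁ ∧
        Even (quadValues e F₁).ncard := by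
  sorry

/-- **stub_quadPairCancel** (the geometric move, the crux of the line): a tame crease of an immersed
fake ball with an even, non-zero number of quadruple values can be traded for a tame crease with an
even and STRICTLY SMALLER number of quadruple values (cancel a pair of quadruple points of the crease
by a Whitney-type move of the immersion `F` that keeps it a local diffeomorphism on `Δ_e`; no
algebraic obstruction since only the mod-2 count is invariant). Size XL / open. -/
theorem stub_quadPairCancel :
    ∀ (S : Literature.Topology.FourManifolds.HomotopySphere 4) (e : EuclideanSpace ℝ (Fin 4) → S.carrier)
      (F : S.carrier → EuclideanSpace ℝ (Fin 4)), Manifold.IsSmoothEmbedding (𝓡 4) (𝓡 4) ∞ e →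
      IsImmersedFakeBall e F → IsTame e F → Even (quadValues e F).ncard → (quadValues e F).Nonempty →
      ∃ F₂ : S.carrier → EuclideanSpace ℝ (Fin 4), IsImmersedFakeBall e F₂ ∧ IsTame e F₂ ∧
        Even (quadValues e F₂).ncard ∧ (quadValues e F₂).ncard < (quadValues e F).ncard := by
  sorry

/-- **The descent (frame form)**: the two stub statements imply the BODY of the piece (parity normalisation,
then well-founded descent on the even number of quadruple values down to zero; conclusion deliberately
unfolded so that only `QuadrupleCancellation_of` below concludes the piece by name — skeleton invariant A12). -/
theorem quad_descent
    (h₁ : ∀ (S : Literature.Topology.FourManifolds.HomotopySphere 4) (e : EuclideanSpace ℝ (Fin 4) → S.carrier)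
      (F : S.carrier → EuclideanSpace ℝ (Fin 4)), Manifold.IsSmoothEmbedding (𝓡 4) (𝓡 4) ∞ e →
      IsImmersedFakeBall e F → IsTame e F →
      ∃ F₁ : S.carrier → EuclideanSpace ℝ (Fin 4), IsImmersedFakeBall e F₁ ∧ IsTame e F₁ ∧
        Even (quadValues e F₁).ncard)
    (h₂ : ∀ (S : Literature.Topology.FourManifolds.HomotopySphere 4) (e : EuclideanSpace ℝ (Fin 4) → S.carrier)
      (F : S.carrier → EuclideanSpace ℝ (Fin 4)), Manifold.IsSmoothEmbedding (𝓡 4) (𝓡 4) ∞ e →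
      IsImmersedFakeBall e F → IsTame e F → Even (quadValues e F).ncard → (quadValues e F).Nonempty →
      ∃ F₂ : S.carrier → EuclideanSpace ℝ (Fin 4), IsImmersedFakeBall e F₂ ∧ IsTame e F₂ ∧
        Even (quadValues e F₂).ncard ∧ (quadValues e F₂).ncard < (quadValues e F).ncard) :
    ∀ (S : Literature.Topology.FourManifolds.HomotopySphere 4) (e : EuclideanSpace ℝ (Fin 4) → S.carrier) (F : S.carrier → EuclideanSpace ℝ (Fin 4)), Manifold.IsSmoothEmbedding (𝓡 4) (𝓡 4) ∞ e → (∀ x, x ∉ e '' Metric.ball (0 : EuclideanSpace ℝ (Fin 4)) 1 → IsLocalDiffeomorphAt (𝓡 4) (𝓡 4) ∞ F x) → {y : EuclideanSpace ℝ (Fin 4) | ∃ a b c d : EuclideanSpace ℝ (Fin 4), ‖a‖ = 1 ∧ ‖b‖ = 1 ∧ ‖c‖ = 1 ∧ ‖d‖ = 1 ∧ a ≠ b ∧ a ≠ c ∧ a ≠ d ∧ b ≠ c ∧ b ≠ d ∧ c ≠ d ∧ F (e a) = y ∧ F (e b) = y ∧ F (e c) = y ∧ F (e d) = y}.Finite →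 {y : EuclideanSpace ℝ (Fin 4) | ∃ a b c d : EuclideanSpace ℝ (Fin 4), ‖a‖ = 1 ∧ ‖b‖ = 1 ∧ ‖c‖ = 1 ∧ ‖d‖ = 1 ∧ a ≠ b ∧ a ≠ c ∧ a ≠ d ∧ b ≠ c ∧ b ≠ d ∧ c ≠ d ∧ F (e a) = y ∧ F (e b) = y ∧ F (e c) = y ∧ F (e d) = y}.Nonempty → ((fun y => connectedComponentIn {y : EuclideanSpace ℝ (Fin 4) | ∃ u v w : EuclideanSpace ℝ (Fin 4), ‖u‖ = 1 ∧ ‖v‖ = 1 ∧ ‖w‖ = 1 ∧ u ≠ v ∧ v ≠ w ∧ u ≠ w ∧ F (e u) = y ∧ F (e v) = y ∧ F (e w) = y} y) '' {y : EuclideanSpace ℝ (Fin 4) | ∃ u v w : EuclideanSpace ℝ (Fin 4), ‖u‖ = 1 ∧ ‖v‖ = 1 ∧ ‖w‖ = 1 ∧ u ≠ v ∧ v ≠ w ∧ u ≠ w ∧ F (e u) = y ∧ F (e v) = y ∧ F (e w) = y}).Finite → ∃ F' : S.carrier → EuclideanSpace ℝ (Fin 4), (∀ x, x ∉ e '' Metric.ball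 (0 : EuclideanSpace ℝ (Fin 4)) 1 → IsLocalDiffeomorphAt (𝓡 4) (𝓡 4) ∞ F' x) ∧ {y : EuclideanSpace ℝ (Fin 4) | ∃ a b c d : EuclideanSpace ℝ (Fin 4), ‖a‖ = 1 ∧ ‖b‖ = 1 ∧ ‖c‖ = 1 ∧ ‖d‖ = 1 ∧ a ≠ b ∧ a ≠ c ∧ a ≠ d ∧ b ≠ c ∧ b ≠ d ∧ c ≠ d ∧ F' (e a) = y ∧ F' (e b) = y ∧ F' (e c) = y ∧ F' (e d) = y}.Finite ∧ {y : EuclideanSpace ℝ (Fin 4) | ∃ a b c d : EuclideanSpace ℝ (Fin 4), ‖a‖ = 1 ∧ ‖b‖ = 1 ∧ ‖c‖ = 1 ∧ ‖d‖ = 1 ∧ a ≠ b ∧ a ≠ c ∧ a ≠ d ∧ b ≠ c ∧ b ≠ d ∧ c ≠ d ∧ F' (e a) = y ∧ F' (e b) = y ∧ F' (e c) = y ∧ F' (e d) = y}.ncard < {y : EuclideanSpace ℝ (Fin 4) | ∃ a b c d : EuclideanSpace ℝ (Fin 4), ‖a‖ = 1 ∧ ‖b‖ = 1 ∧ ‖c‖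 = 1 ∧ ‖d‖ = 1 ∧ a ≠ b ∧ a ≠ c ∧ a ≠ d ∧ b ≠ c ∧ b ≠ d ∧ c ≠ d ∧ F (e a) = y ∧ F (e b) = y ∧ F (e c) = y ∧ F (e d) = y}.ncard ∧ ((fun y => connectedComponentIn {y : EuclideanSpace ℝ (Fin 4) | ∃ u v w : EuclideanSpace ℝ (Fin 4), ‖u‖ = 1 ∧ ‖v‖ = 1 ∧ ‖w‖ = 1 ∧ u ≠ v ∧ v ≠ w ∧ u ≠ w ∧ F' (e u) = y ∧ F' (e v) = y ∧ F' (e w) = y} y) '' {y : EuclideanSpace ℝ (Fin 4) | ∃ u v w : EuclideanSpace ℝ (Fin 4), ‖u‖ = 1 ∧ ‖v‖ = 1 ∧ ‖w‖ = 1 ∧ u ≠ v ∧ v ≠ w ∧ u ≠ w ∧ F' (e u) = y ∧ F' (e v) = y ∧ F' (e w) = y}).Finite := by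
  intro S e F he hF hqf hqne hk
  change IsImmersedFakeBall e F at hF
  change (quadValues e F).Finite at hqf
  change (quadValues e F).Nonempty at hqne
  change (components (tripleValues e F)).Finite at hk
  show ∃ F' : S.carrier → EuclideanSpace ℝ (Fin 4), IsImmersedFakeBall e F' ∧ (quadValues e F').Finite ∧
    (quadValues e F').ncard < (quadValues e F).ncard ∧ (components (tripleValues e F')).Finite
  -- it suffices to reach a tame quadruple-free crease: it has `0 < (quadValues e F).ncard` values
  suffices H : ∃ F' : S.carrier → EuclideanSpace ℝ (Fin 4), IsImmersedFakeBall e F' ∧ IsTame e F' ∧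
      quadValues e F' = ∅ by
    obtain ⟨F', hF', hT', hq'⟩ := H
    refine ⟨F', hF', hT'.1, ?_, hT'.2⟩
    rw [hq', ncard_empty]
    exact (ncard_pos hqf).mpr hqne
  -- parity normalisation
  obtain ⟨F₁, hF₁, hT₁, hev₁⟩ := h₁ S e F he hF ⟨hqf, hk⟩
  -- strong induction on the (even) number of quadruple values
  suffices H : ∀ (n : ℕ) (G : S.carrier → EuclideanSpace ℝ (Fin 4)), IsImmersedFakeBall e G → IsTame e G →
      Even (quadValues e G).ncard → (quadValues e G).ncard = n →
      ∃ F' : S.carrier → EuclideanSpace ℝ (Fin 4), IsImmersedFakeBall e F' ∧ IsTame e F' ∧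
        quadValues e F' = ∅ from H _ F₁ hF₁ hT₁ hev₁ rfl
  intro n
  induction n using Nat.strong_induction_on with
  | _ n ih =>
    intro G hG hTG hev hn
    rcases (quadValues e G).eq_empty_or_nonempty with hqe | hqne'
    · exact ⟨G, hG, hTG, hqe⟩
    · obtain ⟨G', hG', hTG', hev', hlt⟩ := h₂ S e G he hG hTG hev hqne'
      exact ih _ (hn ▸ hlt) G' hG' hTG' hev' rfl

/-- **Composition**: the piece BY NAME from the two declared stubs (while the piece is not yet a route decl,
"by name" is the local verbatim copy `QuadrupleCancellation` above; after `route edit --split CreaseCollapse`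
replace it by `Summit.SmoothPoincare4.SmoothPoincare4.Theses.EuclideanOrigami.QuadrupleCancellation` and
register with `ledger skeleton check … --crux <child item>`). -/
theorem QuadrupleCancellation_of : QuadrupleCancellation :=
  quad_descent stub_quadParity stub_quadPairCancel

end Summit.SmoothPoincare4.SmoothPoincare4.Cruxes.CreaseCollapse.LadderQuad
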